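import Summits.AtomisticToContinuum.Crystallization.Theorems.PerronTransitivityFractionalGainGivesTransitivity

/-!
# Crux `TransitiveLocalLimit` (stmt-AtomisticToContinuum-15100): its FINITE-`N` form

The crux `PerronTransitivity.TransitiveLocalLimit` is an infinite-volume statement (a subsequence,
translations, a local limit set `X`, exact site sums on `X`).  This file proves that it is EQUIVALENT to
a statement about the finite ground states alone, with no limit objects:

  `GoodBalls`:  for every sequence of Lennard-Jones ground states `x N` of `ℝ³`, every radius `R` and
  every tolerance `θ > 0`, FREQUENTLY in `N` some particle `i` of `x N` has ALL particles within
  distance `R` of it `θ`-transitive, `|𝓔ⁱ'(x N) − 2E*| ≤ θ` (`E* = ⨅_Q e_LJ(Q)`).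

* `transitiveLocalLimit_of_goodBalls` — **DOOR 0, the weakest door of all** (`GoodBalls → crux`): pick,
  by `Filter.extraction_forall_of_frequently`, indices `φ k` carrying a level-`k` good ball
  (radius `k+1`, tolerance `1/(k+1)`); centre there, extract a local limit
  (`exists_centredLocalLimit_of_eventually_goodCentre`, the landed centred extraction re-run from
  EVENTUAL good centres along a general index sequence `n j`), and read off exactness of the limit
  site sums from the landed continuity stub `stub_siteEnergyContinuity` — no density statement anywhere.
* `goodBalls_of_transitiveLocalLimit` — the converse (`crux → GoodBalls`): around a particle matched to
  a fixed point `p₀` of the transitive limit `X`, every particle of the `R`-ball is matched to one of the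
  FINITELY many points of `X` in a bounded ball (`finite_of_forall_le_dist_of_subset_closedBall`), at
  each of which the site energies converge to `U_X(p) = 2E*` (continuity stub, finitely many `ε_p`,
  `Filter.eventually_all_finset`); eventually along `σ` is frequently in `N`.
* `transitiveLocalLimit_iff_goodBalls` — the equivalence, concluded with the crux BY NAME on the left.

So stmt-15100 carries no infinite-volume overhead: it says exactly that arbitrarily large,
arbitrarily well energy-equilibrated balls occur in Lennard-Jones ground states infinitely often.
Door 1 of `…EnergeticDoors` (two-sided concentration in density) is the special case "good balls
eventually, around density-one many centres".  All `[folklore]` (compactness bookkeeping).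
-/

noncomputable section

namespace Summit.AtomisticToContinuum.Crystallization.Theorems.TransitiveLocalLimitBirth

open Filter Literature.MathematicalPhysics.StatisticalMechanics
open scoped BigOperators

/-! ## Centred extraction from eventual good centres (general index sequence) -/

/-- **Centred extraction from eventual good centres.** Let `z j : Fin (n j) → ℝᵈ` be uniformly
`δ`-separated finite configurations with real labels `a j i`, and suppose that for every level `k`,
EVENTUALLY in `j`, some particle of `z j` has all particles within distance `k+1` of it labelled
`≤ 1/(k+1)`.  Then after translations `τ j` centring at a particle good at a diagonal level
`K j → ∞`, and along a subsequence `σ`, there is a non-empty `δ`-separated local limit `X` (two-way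
matching on every ball `‖·‖ ≤ R`, eventually) such that for every `R` and `θ > 0`, eventually every
translated particle in the `R`-ball has label `≤ θ`.  (The proof of the landed
`exists_centredLocalLimit`, started one step later.) [folklore] -/
theorem exists_centredLocalLimit_of_eventually_goodCentre {d : ℕ} {n : ℕ → ℕ}
    (z : (j : ℕ) → (Fin (n j) → EuclideanSpace ℝ (Fin d)))
    {δ : ℝ} (hδ : 0 < δ) (hsep : ∀ (j : ℕ) (i i' : Fin (n j)), i ≠ i' → δ ≤ dist (z j i) (z j i'))
    (a : (j : ℕ) → Fin (n j) → ℝ)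
    (hev : ∀ k : ℕ, ∀ᶠ j in atTop, ∃ i : Fin (n j), ∀ i' : Fin (n j),
      dist (z j i) (z j i') ≤ (k : ℝ) + 1 → a j i' ≤ 1 / ((k : ℝ) + 1)) :
    ∃ (X : Set (EuclideanSpace ℝ (Fin d))) (σ : ℕ → ℕ) (τ : ℕ → EuclideanSpace ℝ (Fin d)),
      X.Nonempty ∧ (∀ p ∈ X, ∀ q ∈ X, p ≠ q → δ ≤ dist p q) ∧ StrictMono σ ∧
      (∀ R ε : ℝ, 0 < ε → ∀ᶠ j : ℕ in atTop,
        (∀ p ∈ X, ‖p‖ ≤ R → ∃ i : Fin (n (σ j)), dist (z (σ j) i + τ j) p ≤ ε) ∧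
        (∀ i : Fin (n (σ j)), ‖z (σ j) i + τ j‖ ≤ R → ∃ p ∈ X, dist (z (σ j) i + τ j) p ≤ ε)) ∧
      (∀ R θ : ℝ, 0 < θ → ∀ᶠ j : ℕ in atTop, ∀ i : Fin (n (σ j)), ‖z (σ j) i + τ j‖ ≤ R →
        a (σ j) i ≤ θ) := by
  classical
  -- level-`k` goodness of particle `i` of `z j`: its whole `(k+1)`-ball is `1/(k+1)`-good
  obtain ⟨good, hgood⟩ : ∃ good : (k j : ℕ) → Fin (n j) → Prop, ∀ k j i, good k j i ↔
      ∀ i' : Fin (n j), dist (z j i) (z j i') ≤ (k : ℝ) + 1 → a j i' ≤ 1 / ((k : ℝ) + 1) :=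
    ⟨fun k j i => ∀ i' : Fin (n j), dist (z j i) (z j i') ≤ (k : ℝ) + 1 → a j i' ≤ 1 / ((k : ℝ) + 1),
      fun _ _ _ => Iff.rfl⟩
  -- goodness descends to lower levels
  have hanti : ∀ (k k' j : ℕ) (i : Fin (n j)), good k j i → k' ≤ k → good k' j i := by
    intro k k' j i hi hk
    rw [hgood] at hi ⊢
    intro i' hd
    have hk0 : (k' : ℝ) ≤ k := Nat.cast_le.2 hk
    have hk1 : (k' : ℝ) + 1 ≤ (k : ℝ) + 1 := by linarith
    have hpos : (0 : ℝ) < (k' : ℝ) + 1 := by positivity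
    exact (hi i' (hd.trans hk1)).trans (one_div_le_one_div_of_le hpos hk1)
  -- every level is achieved eventually in `j` (the hypothesis)
  have hev' : ∀ k : ℕ, ∀ᶠ j in atTop, ∃ i : Fin (n j), good k j i := by
    intro k
    filter_upwards [hev k] with j hj
    obtain ⟨i, hi⟩ := hj
    exact ⟨i, (hgood k j i).2 hi⟩
  -- the diagonal level `K j`, achieved at `j` and eventually `≥ k` for every `k`
  obtain ⟨K, hK⟩ := exists_diagonal_level hev'
  -- the centring translation: `-z j i₀` for a particle `i₀` good at level `K j` (when there is one)
  have hc_ex : ∀ j : ℕ, ∃ c : EuclideanSpace ℝ (Fin d), (∃ i, good (K j) j i) →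
      ∃ i : Fin (n j), good (K j) j i ∧ z j i + c = 0 := by
    intro j
    by_cases h : ∃ i, good (K j) j i
    · obtain ⟨i, hi⟩ := h
      exact ⟨-z j i, fun _ => ⟨i, hi, add_neg_cancel (z j i)⟩⟩
    · exact ⟨0, fun h' => absurd h' h⟩
  choose ctr hctr using hc_ex
  -- the translated point sets are `δ`-separated: extract a locally convergent subsequence
  have hYsep : ∀ j : ℕ, ∀ p ∈ Set.range (fun i : Fin (n j) => z j i + ctr j),
      ∀ q ∈ Set.range (fun i : Fin (n j) => z j i + ctr j), p ≠ q → δ ≤ dist p q := by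
    rintro j _ ⟨i, rfl⟩ _ ⟨i', rfl⟩ hii'
    show δ ≤ dist (z j i + ctr j) (z j i' + ctr j)
    rw [dist_add_right]
    exact hsep j i i' fun h => hii' (by rw [h])
  obtain ⟨φ, X, hφ, hXsep, hlim⟩ :=
    exists_subseq_forall_eventually_ballMatch hδ
      (fun j => Set.range fun i : Fin (n j) => z j i + ctr j) hYsep
  refine ⟨X, φ, fun j => ctr (φ j), ?_, hXsep, hφ, fun R ε hε => ?_, fun R θ hθ => ?_⟩
  · -- non-empty: the centre `0` of a late translated configuration is matched to a point of `X`
    have h0 : ∀ᶠ j in atTop, (0 : EuclideanSpace ℝ (Fin d)) ∈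
        Set.range (fun i : Fin (n j) => z j i + ctr j) := by
      filter_upwards [hK 0] with j hj
      obtain ⟨i, -, hi⟩ := hctr j hj.2
      exact ⟨i, hi⟩
    obtain ⟨j, hj0, hj⟩ := ((hφ.tendsto_atTop.eventually h0).and (hlim 0 1 one_pos)).exists
    obtain ⟨p, hp, -⟩ := hj.2 0 hj0 (dist_self (0 : EuclideanSpace ℝ (Fin d))).le
    exact ⟨p, hp⟩
  · -- two-way matching on balls: `BallMatch` unfolded
    filter_upwards [hlim R ε hε] with j hj
    exact (ballMatch_zero_range_iff (X := X) (fun i : Fin (n (φ j)) => z (φ j) i + ctr (φ j)) ε R).1 hj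
  · -- goodness: late centres are good at a level `k` with `R ≤ k + 1` and `1/(k+1) ≤ θ`
    obtain ⟨k, hk⟩ := exists_nat_ge (max R (1 / θ))
    have hk1 : (k : ℝ) ≤ (k : ℝ) + 1 := le_add_of_nonneg_right zero_le_one
    have hRk : R ≤ (k : ℝ) + 1 := (le_max_left _ _).trans (hk.trans hk1)
    have hθk : 1 / ((k : ℝ) + 1) ≤ θ := by
      rw [one_div_le (by positivity) hθ]
      exact (le_max_right _ _).trans (hk.trans hk1)
    filter_upwards [hφ.tendsto_atTop.eventually (hK k)] with j hj
    obtain ⟨hkK, hex⟩ := hj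
    intro i hi
    obtain ⟨i₀, hi₀, h0⟩ := hctr (φ j) hex
    have hgoodk : good k (φ j) i₀ := hanti _ _ _ i₀ hi₀ hkK
    rw [hgood] at hgoodk
    have hc : ctr (φ j) = -z (φ j) i₀ := eq_neg_of_add_eq_zero_right h0
    have hdist : dist (z (φ j) i₀) (z (φ j) i) ≤ (k : ℝ) + 1 := by
      rw [dist_comm, dist_eq_norm, sub_eq_add_neg, ← hc]
      exact le_trans hi hRk
    exact (hgoodk i hdist).trans hθk

/-! ## Door 0: good balls frequently ⇒ the crux -/

/-- **DOOR 0 — good balls frequently give the crux.** If along every sequence of Lennard-Jones ground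
states of `ℝ³`, for every radius `R` and tolerance `θ > 0`, FREQUENTLY in `N` some particle has all
particles within distance `R` of it `θ`-transitive (`|𝓔ⁱ'(x N) − 2E*| ≤ θ`, `E* = ⨅_Q e_LJ(Q)`), then
`TransitiveLocalLimit` (conclusion spelled out: the text of the route decl). Proof: extract indices
`φ k` carrying level-`k` good balls (`Filter.extraction_forall_of_frequently`), centre and extract a
local limit (`exists_centredLocalLimit_of_eventually_goodCentre`, minimal distance of ground states),
and exactness of the limit site sums by the landed continuity stub `stub_siteEnergyContinuity`.
[folklore] -/
theorem transitiveLocalLimit_of_goodBalls : (∀ x : (N : ℕ) → (Fin N → EuclideanSpace ℝ (Fin 3)), (∀ N, Literature.MathematicalPhysics.StatisticalMechanics.IsGroundState Literature.MathematicalPhysics.StatisticalMechanics.lennardJones (x N)) → ∀ R θ : ℝ, 0 < θ → ∃ᶠ N in Filter.atTop, ∃ i : Fin N, ∀ i' : Fin N, dist (x N i) (x N i') ≤ R → |Literature.MathematicalPhysics.StatisticalMechanics.siteEnergy Literature.MathematicalPhysics.StatisticalMechanics.lennardJones (x N) i' - 2 * (⨅ Q : Literature.MathematicalPhysics.StatisticalMechanics.PeriodicConfiguration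 3, Q.energyPerParticle Literature.MathematicalPhysics.StatisticalMechanics.lennardJones)| ≤ θ) → ∀ x : (N : ℕ) → (Fin N → EuclideanSpace ℝ (Fin 3)), (∀ N, Literature.MathematicalPhysics.StatisticalMechanics.IsGroundState Literature.MathematicalPhysics.StatisticalMechanics.lennardJones (x N)) → ∃ (X : Set (EuclideanSpace ℝ (Fin 3))) (σ : ℕ → ℕ) (τ : ℕ → EuclideanSpace ℝ (Fin 3)), X.Nonempty ∧ (∃ δ : ℝ, 0 < δ ∧ ∀ p ∈ X, ∀ q ∈ X, p ≠ q → δ ≤ dist p q) ∧ StrictMono σ ∧ (∀ R ε : ℝ, 0 < ε → ∀ᶠ j : ℕ in Filter.atTop, (∀ p ∈ X, ‖p‖ ≤ R → ∃ i : Fin (σ j), dist (x (σ j) i + τ j) p ≤ ε) ∧ (∀ i : Fin (σ j), ‖x (σ j) i + τ j‖ ≤ R → ∃ p ∈ X, dist (x (σ j) i + τ j) p ≤ ε)) ∧ ∀ p ∈ X, ∑' q : {q : EuclideanSpace ℝ (Fin 3) // q ∈ X ∧ q ≠ p}, Literature.MathematicalPhysics.StatisticalMechanics.lennardJones (dist p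 q.1) = 2 * ⨅ Q : Literature.MathematicalPhysics.StatisticalMechanics.PeriodicConfiguration 3, Q.energyPerParticle Literature.MathematicalPhysics.StatisticalMechanics.lennardJones := by
  intro h0 x hx
  set E : ℝ := ⨅ Q : PeriodicConfiguration 3, Q.energyPerParticle lennardJones with hE
  -- uniform minimal distance of Lennard-Jones ground states (PROVED in tree)
  obtain ⟨δ, hδ, hδsep⟩ := LennardJonesMinimalDistance_holds
  -- level-`k` good balls occur frequently; extract one index per level
  have hfreq : ∀ k : ℕ, ∃ᶠ N in atTop, ∃ i : Fin N, ∀ i' : Fin N,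
      dist (x N i) (x N i') ≤ (k : ℝ) + 1 →
        |siteEnergy lennardJones (x N) i' - 2 * E| ≤ 1 / ((k : ℝ) + 1) :=
    fun k => h0 x hx ((k : ℝ) + 1) (1 / ((k : ℝ) + 1)) (by positivity)
  obtain ⟨φ, hφ, hφP⟩ := extraction_forall_of_frequently hfreq
  -- along `φ`, every level is achieved eventually (level `j ≥ k` implies level `k`)
  have hev : ∀ k : ℕ, ∀ᶠ j in atTop, ∃ i : Fin (φ j), ∀ i' : Fin (φ j),
      dist (x (φ j) i) (x (φ j) i') ≤ (k : ℝ) + 1 →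
        |siteEnergy lennardJones (x (φ j)) i' - 2 * E| ≤ 1 / ((k : ℝ) + 1) := by
    intro k
    filter_upwards [eventually_ge_atTop k] with j hj
    obtain ⟨i, hi⟩ := hφP j
    refine ⟨i, fun i' hd => ?_⟩
    have hk0 : (k : ℝ) ≤ j := Nat.cast_le.2 hj
    have hk1 : (k : ℝ) + 1 ≤ (j : ℝ) + 1 := by linarith
    have hpos : (0 : ℝ) < (k : ℝ) + 1 := by positivity
    exact (hi i' (hd.trans hk1)).trans (one_div_le_one_div_of_le hpos hk1)
  -- centred extraction along `z j := x (φ j)`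
  obtain ⟨X, σ, τ, hne, hXsep, hσ, hmatch, hgood⟩ :=
    exists_centredLocalLimit_of_eventually_goodCentre (n := φ) (fun j => x (φ j)) hδ
      (fun j i i' h => hδsep (φ j) (x (φ j)) (hx (φ j)) i i' h)
      (fun j i => |siteEnergy lennardJones (x (φ j)) i - 2 * E|) hev
  refine ⟨X, fun j => φ (σ j), τ, hne, ⟨δ, hδ, hXsep⟩, fun j j' h => hφ (hσ h), hmatch,
    fun p hp => ?_⟩
  -- continuity of site energies along the translated subsequence, at the limit point `p`
  have hzsep : ∀ (j : ℕ) (i i' : Fin (φ (σ j))), i ≠ i' →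
      δ ≤ dist (x (φ (σ j)) i + τ j) (x (φ (σ j)) i' + τ j) := by
    intro j i i' hii'
    rw [dist_add_right]
    exact hδsep _ _ (hx _) i i' hii'
  have hcont := stub_siteEnergyContinuity (fun j => φ (σ j)) (fun j i => x (φ (σ j)) i + τ j) X δ hδ
    hzsep ⟨δ, hδ, hXsep⟩ hmatch p hp
  -- the site sum of `X` at `p` is within every `γ > 0` of `2E*`
  refine eq_of_forall_dist_le fun γ hγ => ?_
  obtain ⟨ε, hε, hεj⟩ := hcont (γ / 2) (half_pos hγ)
  have e2 := hmatch ‖p‖ (min ε 1) (lt_min hε one_pos)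
  have e3 := hgood (‖p‖ + 1) (γ / 2) (half_pos hγ)
  obtain ⟨j, hj1, ⟨hj2, -⟩, hj3⟩ := (hεj.and (e2.and e3)).exists
  obtain ⟨i, hi⟩ := hj2 p hp le_rfl
  have hiε : dist (x (φ (σ j)) i + τ j) p ≤ ε := hi.trans (min_le_left _ _)
  have hi1 : dist (x (φ (σ j)) i + τ j) p ≤ 1 := hi.trans (min_le_right _ _)
  have hnorm : ‖x (φ (σ j)) i + τ j‖ ≤ ‖p‖ + 1 := by
    have h := norm_le_norm_add_norm_sub' (x (φ (σ j)) i + τ j) p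
    rw [← dist_eq_norm] at h
    linarith
  -- particle `i` is late and close to `p`: its site energy is `γ/2`-close to both `U_X(p)` and `2E*`
  have hA : |siteEnergy lennardJones (x (φ (σ j))) i -
      ∑' q : {q : EuclideanSpace ℝ (Fin 3) // q ∈ X ∧ q ≠ p}, lennardJones (dist p q.1)| ≤ γ / 2 := by
    simpa only [siteEnergy_add_const] using hj1 i hiε
  have hB := hj3 i hnorm
  rw [abs_sub_comm] at hA
  rw [Real.dist_eq]
  exact (abs_sub_le _ _ _).trans ((add_le_add hA hB).trans_eq (add_halves γ))

/-! ## The converse: the crux ⇒ good balls frequently -/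

/-- **The crux gives good balls frequently.** If a sequence of Lennard-Jones ground states has an
exactly transitive local limit `X` along `σ`, `τ` (the text of `TransitiveLocalLimit` for this
sequence), then for every `R` and `θ > 0`, frequently in `N`, some particle has its whole `R`-ball
`θ`-transitive.  Around a particle matched to a fixed `p₀ ∈ X`, every particle of the `R`-ball is
matched to one of the finitely many points of `X` of norm `≤ ‖p₀‖ + |R| + 3`
(`finite_of_forall_le_dist_of_subset_closedBall`), where the site energies converge to `2E*`
(`stub_siteEnergyContinuity`, finitely many tolerances, `Filter.eventually_all_finset`). [folklore] -/
theorem goodBalls_of_transitiveLocalLimit_seq (x : (N : ℕ) → (Fin N → EuclideanSpace ℝ (Fin 3)))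
    (hx : ∀ N, IsGroundState lennardJones (x N))
    (hT : ∃ (X : Set (EuclideanSpace ℝ (Fin 3))) (σ : ℕ → ℕ) (τ : ℕ → EuclideanSpace ℝ (Fin 3)),
      X.Nonempty ∧ (∃ δ : ℝ, 0 < δ ∧ ∀ p ∈ X, ∀ q ∈ X, p ≠ q → δ ≤ dist p q) ∧ StrictMono σ ∧
      (∀ R ε : ℝ, 0 < ε → ∀ᶠ j : ℕ in atTop,
        (∀ p ∈ X, ‖p‖ ≤ R → ∃ i : Fin (σ j), dist (x (σ j) i + τ j) p ≤ ε) ∧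
        (∀ i : Fin (σ j), ‖x (σ j) i + τ j‖ ≤ R → ∃ p ∈ X, dist (x (σ j) i + τ j) p ≤ ε)) ∧
      ∀ p ∈ X, ∑' q : {q : EuclideanSpace ℝ (Fin 3) // q ∈ X ∧ q ≠ p}, lennardJones (dist p q.1) =
        2 * ⨅ Q : PeriodicConfiguration 3, Q.energyPerParticle lennardJones)
    (R : ℝ) {θ : ℝ} (hθ : 0 < θ) :
    ∃ᶠ N in atTop, ∃ i : Fin N, ∀ i' : Fin N, dist (x N i) (x N i') ≤ R →
      |siteEnergy lennardJones (x N) i' -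
        2 * (⨅ Q : PeriodicConfiguration 3, Q.energyPerParticle lennardJones)| ≤ θ := by
  classical
  set E : ℝ := ⨅ Q : PeriodicConfiguration 3, Q.energyPerParticle lennardJones with hE
  obtain ⟨X, σ, τ, ⟨p₀, hp₀⟩, ⟨δX, hδX, hXsep⟩, hσ, hmatch, hU⟩ := hT
  obtain ⟨δ, hδ, hδsep⟩ := LennardJonesMinimalDistance_holds
  -- radius in limit coordinates covering the `R`-ball around a particle matched to `p₀`
  set R' : ℝ := ‖p₀‖ + 1 + |R| with hR'
  -- the finitely many limit points of norm `≤ R' + 1`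
  set XB : Set (EuclideanSpace ℝ (Fin 3)) := {p | p ∈ X ∧ ‖p‖ ≤ R' + 1} with hXB
  have hfin : XB.Finite :=
    finite_of_forall_le_dist_of_subset_closedBall hδX
      (fun p hp q hq hpq => hXsep p hp.1 q hq.1 hpq) (c := 0) (R := R' + 1)
      (fun p hp => by
        rw [Metric.mem_closedBall, dist_zero_right]
        exact hp.2)
  -- continuity of the site energies at every point of `X` (landed stub 4)
  have hzsep : ∀ (j : ℕ) (i i' : Fin (σ j)), i ≠ i' →
      δ ≤ dist (x (σ j) i + τ j) (x (σ j) i' + τ j) := by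
    intro j i i' hii'
    rw [dist_add_right]
    exact hδsep _ _ (hx _) i i' hii'
  have hcont := stub_siteEnergyContinuity σ (fun j i => x (σ j) i + τ j) X δ hδ hzsep
    ⟨δX, hδX, hXsep⟩ hmatch
  have hc : ∀ p : EuclideanSpace ℝ (Fin 3), ∃ ε : ℝ, 0 < ε ∧ (p ∈ X → ∀ᶠ j : ℕ in atTop,
      ∀ i : Fin (σ j), dist (x (σ j) i + τ j) p ≤ ε →
        |siteEnergy lennardJones (fun i => x (σ j) i + τ j) i -
          ∑' q : {q : EuclideanSpace ℝ (Fin 3) // q ∈ X ∧ q ≠ p}, lennardJones (dist p q.1)| ≤ θ) := by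
    intro p
    by_cases hp : p ∈ X
    · obtain ⟨ε, hε, h⟩ := hcont p hp θ hθ
      exact ⟨ε, hε, fun _ => h⟩
    · exact ⟨1, one_pos, fun h => absurd h hp⟩
  choose εf hεf hevf using hc
  -- one tolerance for the finitely many relevant limit points, at most `1`
  have hTne : hfin.toFinset.Nonempty :=
    ⟨p₀, hfin.mem_toFinset.2 ⟨hp₀, by rw [hR']; linarith [abs_nonneg R]⟩⟩
  set ε : ℝ := min 1 (hfin.toFinset.inf' hTne εf) with hεdef
  have hεpos : 0 < ε := lt_min one_pos ((Finset.lt_inf'_iff hTne).2 fun p _ => hεf p)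
  have hε1 : ε ≤ 1 := min_le_left _ _
  have hεle : ∀ p ∈ hfin.toFinset, ε ≤ εf p :=
    fun p hp => (min_le_right _ _).trans (Finset.inf'_le εf hp)
  -- eventually along `σ`: continuity at every relevant limit point, and matching at radius `R'`
  have hev1 : ∀ᶠ j : ℕ in atTop, ∀ p ∈ hfin.toFinset, ∀ i : Fin (σ j),
      dist (x (σ j) i + τ j) p ≤ εf p →
        |siteEnergy lennardJones (fun i => x (σ j) i + τ j) i -
          ∑' q : {q : EuclideanSpace ℝ (Fin 3) // q ∈ X ∧ q ≠ p}, lennardJones (dist p q.1)| ≤ θ :=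
    (eventually_all_finset hfin.toFinset).2 fun p hp => hevf p (hfin.mem_toFinset.1 hp).1
  have hev2 := hmatch R' ε hεpos
  have hall : ∀ᶠ j : ℕ in atTop, ∃ i : Fin (σ j), ∀ i' : Fin (σ j),
      dist (x (σ j) i) (x (σ j) i') ≤ R → |siteEnergy lennardJones (x (σ j)) i' - 2 * E| ≤ θ := by
    filter_upwards [hev1, hev2] with j h1 h2
    -- the centre: a particle matched to `p₀`
    have hp₀R : ‖p₀‖ ≤ R' := by rw [hR']; linarith [abs_nonneg R]
    obtain ⟨i₀, hi₀⟩ := h2.1 p₀ hp₀ hp₀R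
    refine ⟨i₀, fun i' hd => ?_⟩
    have hn0 : ‖x (σ j) i₀ + τ j‖ ≤ ‖p₀‖ + 1 := by
      have h := norm_le_norm_add_norm_sub' (x (σ j) i₀ + τ j) p₀
      rw [← dist_eq_norm] at h
      linarith
    have hn' : ‖x (σ j) i' + τ j‖ ≤ R' := by
      have h := norm_le_norm_add_norm_sub' (x (σ j) i' + τ j) (x (σ j) i₀ + τ j)
      rw [← dist_eq_norm, dist_add_right, dist_comm] at h
      rw [hR']
      linarith [le_abs_self R]
    -- the particle `i'` is matched to a relevant limit point `p`
    obtain ⟨p, hpX, hpd⟩ := h2.2 i' hn'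
    have hpB : p ∈ hfin.toFinset := by
      refine hfin.mem_toFinset.2 ⟨hpX, ?_⟩
      have h := norm_le_norm_add_norm_sub' p (x (σ j) i' + τ j)
      rw [← dist_eq_norm, dist_comm] at h
      linarith
    have h3 := h1 p hpB i' (hpd.trans (hεle p hpB))
    rw [siteEnergy_add_const, hU p hpX] at h3
    exact h3
  exact hσ.tendsto_atTop.frequently
    (p := fun N => ∃ i : Fin N, ∀ i' : Fin N, dist (x N i) (x N i') ≤ R →
      |siteEnergy lennardJones (x N) i' - 2 * E| ≤ θ) hall.frequently

/-- **The crux ⇒ good balls frequently** (for all ground-state sequences): the hypothesis is the route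
decl `TransitiveLocalLimit` BY NAME. [folklore] -/
theorem goodBalls_of_transitiveLocalLimit
    (hT : Summit.AtomisticToContinuum.Crystallization.Theses.PerronTransitivity.TransitiveLocalLimit)
    (x : (N : ℕ) → (Fin N → EuclideanSpace ℝ (Fin 3))) (hx : ∀ N, IsGroundState lennardJones (x N))
    (R : ℝ) {θ : ℝ} (hθ : 0 < θ) :
    ∃ᶠ N in atTop, ∃ i : Fin N, ∀ i' : Fin N, dist (x N i) (x N i') ≤ R →
      |siteEnergy lennardJones (x N) i' -
        2 * (⨅ Q : PeriodicConfiguration 3, Q.energyPerParticle lennardJones)| ≤ θ :=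
  goodBalls_of_transitiveLocalLimit_seq x hx (hT x hx) R hθ

/-! ## The equivalence -/

/-- **FINITE-`N` FORM OF THE CRUX.** `TransitiveLocalLimit` (stmt-AtomisticToContinuum-15100) holds if
and only if along every sequence of Lennard-Jones ground states of `ℝ³`, for every radius `R` and
tolerance `θ > 0`, frequently in `N`, some particle has all particles within distance `R` of it with
site energy within `θ` of `2E*` (`E* = ⨅_Q e_LJ(Q)`): arbitrarily large, arbitrarily well
energy-equilibrated balls occur in the ground states infinitely often.  (`transitiveLocalLimit_of_goodBalls`
and `goodBalls_of_transitiveLocalLimit`.) [folklore] -/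
theorem transitiveLocalLimit_iff_goodBalls : Summit.AtomisticToContinuum.Crystallization.Theses.PerronTransitivity.TransitiveLocalLimit ↔ (∀ x : (N : ℕ) → (Fin N → EuclideanSpace ℝ (Fin 3)), (∀ N, Literature.MathematicalPhysics.StatisticalMechanics.IsGroundState Literature.MathematicalPhysics.StatisticalMechanics.lennardJones (x N)) → ∀ R θ : ℝ, 0 < θ → ∃ᶠ N in Filter.atTop, ∃ i : Fin N, ∀ i' : Fin N, dist (x N i) (x N i') ≤ R → |Literature.MathematicalPhysics.StatisticalMechanics.siteEnergy Literature.MathematicalPhysics.StatisticalMechanics.lennardJones (x N) i' - 2 * (⨅ Q : Literature.MathematicalPhysics.StatisticalMechanics.PeriodicConfiguration 3, Q.energyPerParticle Literature.MathematicalPhysics.StatisticalMechanics.lennardJones)| ≤ θ) :=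
  ⟨fun hT x hx R _θ hθ => goodBalls_of_transitiveLocalLimit hT x hx R hθ,
    fun h0 => transitiveLocalLimit_of_goodBalls h0⟩

end Summit.AtomisticToContinuum.Crystallization.Theorems.TransitiveLocalLimitBirth

end
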